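import Mathlib.LinearAlgebra.FreeModule.PID
import Mathlib.LinearAlgebra.Basis.SMul
import Mathlib.LinearAlgebra.Dimension.StrongRankCondition
import Mathlib.RingTheory.DiscreteValuationRing.Basic
import HarnessLib

/-!
# Orbits of lattice vectors under the lattice automorphism group — module-theoretic ingredient of WANTED
# XXVII (the hull LOWER bound for the (Ind2)-orbit of [IUTchIV] Prop. 1.2 / Dupuy–Hilado §4.9, §4.12) (skeleton XXVIIa)

Record-only support file (D-0012) of the abc-iut cell (skeleton seat abc-iut-skel, gen 6; generic module theory,
filed under the fork directory because it is the skeleton's XXVII ingredient, not a published IUT statement);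
TAKES NO SIDE. Dupuy–Hilado, arXiv:2004.13228 §4.9 "`p`-adic Ind2": the indeterminacy (Ind2) acts through
`Aut_{ℚ_p}(K_{v⃗} : I_{v⃗})`, "`ℚ_p`-vector space automorphisms which arise as `ℤ_p`-lattice isomorphisms of
`I_{v̲}`" (tree: `LatticeAutomorphisms.latticeAut`, `latticeAut.restrict : Λ ≃ₗ[ℤ_p] Λ`); §4.12: the hull of the
orbit `U_Θ` is "the smallest possible module containing this regions". [IUTchIV] Prop. 1.2 (ii) (kurims p. 10)
bounds `φ(p^λ·(R_I)^∼)` for EVERY such `φ` from ABOVE; a bound from BELOW for the hull of the union over all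
`φ` needs to know how large the orbit `GL(Λ)·x` of a lattice vector `x` is. This file records the module-theoretic
facts (finite free modules over a PID; Smith normal form, Mathlib `Submodule.smithNormalForm`):

* `exists_eq_smul_basis_vector` — every nonzero vector of a finite free module over a PID is a nonzero multiple
  `a • b i` of a vector of SOME basis (Smith normal form of the rank-one submodule it spans);
* `associated_of_eq_smul_basis_vector` — the coefficient `a` (the CONTENT of `x`) is well defined up to units;
* `exists_linearEquiv_apply_eq_of_eq_smul` / `exists_linearEquiv_apply_eq_of_associated` — **the automorphism
  group of the module acts TRANSITIVELY on vectors of equal (associated) content** (`b.equiv b'` after a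
  permutation of indices and a unit rescaling, `Basis.unitsSMul`);
* over a discrete valuation ring with uniformizer `ϖ` (e.g. `ℤ_p`, `ϖ = p`): `associated_pow_of_dvd_not_dvd` — a
  vector `x = a • b i` with `ϖ^m ∣ a`, `ϖ^{m+1} ∤ a` has content `ϖ^m`; hence
  `exists_linearEquiv_apply_eq_of_depth` — two vectors of the same exact `ϖ`-depth are conjugate under a
  module automorphism: the `GL(Λ)`-orbit of a depth-`m` vector is ALL of `ϖ^m·Prim(Λ)`.

Consumer (not here): the lower bound `p^m·hull(I_{v⃗}) ⊆ hull(⋃_{φ ∈ Ind2} φ(ι(t)·(R_I)^∼))` that makes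
[IUTchIV] Thm. 1.10 Step (v)'s per-summand bound sharp up to rounding (abc-iut skeleton memo
HOME/skel/FORK-REAL-MODEL.md §4; WANTED XXVII). [cite: DupuyHilado2025, §4.9, §4.12]
[cite: Mochizuki2012, IUTchIV Prop. 1.2 (ii) p. 10] Everything proved is standard module theory ([folklore]).
-/

namespace Summit.ABC.IUTFork

namespace LatticeOrbits

open Module

variable {R : Type*} [CommRing R] {M : Type*} [AddCommGroup M] [Module R M] {ι : Type*}

/-! ## 1. Transitivity on presented vectors (any commutative ring) -/

/-- If `x = a • b i` and `y = a • b' i'` for bases `b, b'` and the SAME coefficient `a`, the automorphism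
`b ≃ b'` composed with the index transposition `i ↔ i'` maps `x` to `y`. [folklore] -/
theorem exists_linearEquiv_apply_eq_of_eq_smul [DecidableEq ι] (b b' : Basis ι R M) {i i' : ι} {a : R}
    {x y : M} (hx : x = a • b i) (hy : y = a • b' i') : ∃ φ : M ≃ₗ[R] M, φ x = y :=
  ⟨b.equiv b' (Equiv.swap i i'), by rw [hx, map_smul, Basis.equiv_apply, Equiv.swap_apply_left, hy]⟩

/-- The same when the coefficients are merely ASSOCIATED (`a' = a·u`, `u` a unit): rescale the target basis
vector by `u` (`Basis.unitsSMul`). [folklore] -/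
theorem exists_linearEquiv_apply_eq_of_associated [DecidableEq ι] (b b' : Basis ι R M) {i i' : ι}
    {a a' : R} {x y : M} (hx : x = a • b i) (hy : y = a' • b' i') (h : Associated a a') :
    ∃ φ : M ≃ₗ[R] M, φ x = y := by
  obtain ⟨u, rfl⟩ := h
  let w : ι → Rˣ := Function.update (fun _ => 1) i' u
  have hy' : y = a • (b'.unitsSMul w) i' := by
    rw [Basis.unitsSMul_apply, hy]
    simp only [w, Function.update_self]
    rw [Units.smul_def, smul_smul]
  exact exists_linearEquiv_apply_eq_of_eq_smul b (b'.unitsSMul w) hx hy'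

/-- The content is well defined: if `x = a • b i = a' • b' i'` then `a ∣ a'` (read the coordinate of `x` along
`b' i'`). [folklore] -/
theorem dvd_of_eq_smul_basis_vector (b b' : Basis ι R M) {i i' : ι} {a a' : R} {x : M}
    (hx : x = a • b i) (hx' : x = a' • b' i') : a ∣ a' := by
  classical
  refine ⟨b'.coord i' (b i), ?_⟩
  have h1 : b'.coord i' x = a' := by
    rw [hx', map_smul, Basis.coord_apply, Basis.repr_self, Finsupp.single_eq_same, smul_eq_mul, mul_one]
  have h2 : b'.coord i' x = a * b'.coord i' (b i) := by rw [hx, map_smul, smul_eq_mul]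
  rw [← h1, h2]

/-- … hence `a` and `a'` are associated (in a domain, from a nonzero vector). [folklore] -/
theorem associated_of_eq_smul_basis_vector [IsDomain R] (b b' : Basis ι R M) {i i' : ι} {a a' : R} {x : M}
    (hx : x = a • b i) (hx' : x = a' • b' i') : Associated a a' :=
  associated_of_dvd_dvd (dvd_of_eq_smul_basis_vector b b' hx hx') (dvd_of_eq_smul_basis_vector b' b hx' hx)

/-! ## 2. Every nonzero vector is a multiple of a basis vector (PID, finite rank) -/

section PID

variable [IsDomain R] [IsPrincipalIdealRing R] [Finite ι]

/-- **Every nonzero vector of a finite free module over a PID is `a • b' i` for some basis `b'`, index `i` and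
nonzero `a`** — the Smith normal form of the rank-one submodule `R ∙ x` (Mathlib `Submodule.smithNormalForm`).
[folklore] -/
theorem exists_eq_smul_basis_vector (b : Basis ι R M) {x : M} (hx : x ≠ 0) :
    ∃ (b' : Basis ι R M) (i : ι) (a : R), a ≠ 0 ∧ x = a • b' i := by
  classical
  haveI : Module.IsTorsionFree R M := b.isTorsionFree
  obtain ⟨n, snf⟩ := (R ∙ x).smithNormalForm b
  -- the span of `x` has rank one
  have hli : LinearIndependent R (fun _ : Unit => x) := linearIndependent_unique_iff.mpr hx
  have h1 : Module.finrank R (R ∙ x) = 1 := by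
    have h := Module.finrank_eq_card_basis (Basis.span hli)
    rw [Set.range_const] at h
    simpa using h
  have h2 : Module.finrank R (R ∙ x) = n := by simpa using Module.finrank_eq_card_basis snf.bN
  have hn : n = 1 := by rw [← h2, h1]
  subst hn
  -- read `x` in the one-element basis of `R ∙ x`
  let xN : (R ∙ x) := ⟨x, Submodule.mem_span_singleton_self x⟩
  have hrepr : (snf.bN.repr xN 0) • snf.bN 0 = xN := by
    have := snf.bN.sum_repr xN
    rwa [Fin.sum_univ_one] at this
  have hxM : x = (snf.bN.repr xN 0 * snf.a 0) • snf.bM (snf.f 0) := by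
    have h := congrArg (fun z : (R ∙ x) => (z : M)) hrepr
    simp only [Submodule.coe_smul_of_tower] at h
    rw [snf.snf 0, smul_smul] at h
    exact h.symm
  refine ⟨snf.bM, snf.f 0, snf.bN.repr xN 0 * snf.a 0, ?_, hxM⟩
  intro h0
  rw [h0, zero_smul] at hxM
  exact hx hxM

end PID

/-! ## 3. Over a discrete valuation ring: content = exact depth -/

section DVR

variable [IsDomain R] [IsDiscreteValuationRing R]

/-- In a DVR with uniformizer `ϖ`: if `ϖ^m ∣ a` and `ϖ^{m+1} ∤ a` then `a ∼ ϖ^m`. [folklore] -/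
theorem associated_pow_of_dvd_not_dvd {ϖ : R} (hϖ : Irreducible ϖ) {a : R} {m : ℕ} (h1 : ϖ ^ m ∣ a)
    (h2 : ¬ ϖ ^ (m + 1) ∣ a) : Associated a (ϖ ^ m) := by
  have ha : a ≠ 0 := fun h => h2 (h ▸ dvd_zero _)
  obtain ⟨n, u, hu⟩ := IsDiscreteValuationRing.associated_pow_irreducible ha hϖ
  -- `a * u = ϖ ^ n`
  have hϖ0 : ϖ ≠ 0 := hϖ.ne_zero
  have hϖu : ¬ IsUnit ϖ := hϖ.not_isUnit
  have ha' : a = ϖ ^ n * ↑u⁻¹ := by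
    rw [← hu, mul_assoc, Units.mul_inv, mul_one]
  have hmn : m ≤ n := by
    have h : ϖ ^ m ∣ ϖ ^ n := by
      have := h1
      rw [ha', Units.dvd_mul_right] at this
      exact this
    exact (pow_dvd_pow_iff hϖ0 hϖu).mp h
  have hnm : n ≤ m := by
    by_contra hlt
    have hle : m + 1 ≤ n := by omega
    apply h2
    rw [ha', Units.dvd_mul_right]
    exact pow_dvd_pow ϖ hle
  have hmn' : n = m := le_antisymm hnm hmn
  subst hmn'
  exact ⟨u, hu⟩

/-- **Two lattice vectors of the same exact `ϖ`-depth are conjugate under `Aut(M)`**: if `x = a • b i`,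
`y = a' • b' i'` with `ϖ^m ∣ a, a'` and `ϖ^{m+1} ∤ a, a'`, some linear automorphism of `M` maps `x` to `y` — the
`GL(Λ)`-orbit of a depth-`m` vector is the whole of `ϖ^m·Prim(Λ)`. [folklore] -/
theorem exists_linearEquiv_apply_eq_of_depth (b b' : Basis ι R M) {ϖ : R} (hϖ : Irreducible ϖ) {m : ℕ}
    {i i' : ι} {a a' : R} {x y : M} (hx : x = a • b i) (hy : y = a' • b' i')
    (hxa : ϖ ^ m ∣ a) (hxa' : ¬ ϖ ^ (m + 1) ∣ a) (hya : ϖ ^ m ∣ a') (hya' : ¬ ϖ ^ (m + 1) ∣ a') :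
    ∃ φ : M ≃ₗ[R] M, φ x = y := by
  classical
  exact exists_linearEquiv_apply_eq_of_associated b b' hx hy
    ((associated_pow_of_dvd_not_dvd hϖ hxa hxa').trans (associated_pow_of_dvd_not_dvd hϖ hya hya').symm)

/-- In particular a depth-`m` vector is conjugate to `ϖ^m • b' i'` for EVERY basis `b'` and index `i'`.
[folklore] -/
theorem exists_linearEquiv_apply_eq_pow_smul (b b' : Basis ι R M) {ϖ : R} (hϖ : Irreducible ϖ) {m : ℕ}
    {i : ι} (i' : ι) {a : R} {x : M} (hx : x = a • b i) (hxa : ϖ ^ m ∣ a) (hxa' : ¬ ϖ ^ (m + 1) ∣ a) :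
    ∃ φ : M ≃ₗ[R] M, φ x = ϖ ^ m • b' i' := by
  refine exists_linearEquiv_apply_eq_of_depth b b' hϖ hx rfl hxa hxa' dvd_rfl ?_
  rw [pow_dvd_pow_iff hϖ.ne_zero hϖ.not_isUnit]
  omega

end DVR

end LatticeOrbits

end Summit.ABC.IUTFork
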